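import Literature.NumberTheory.LFunctions.SymmetricHadamardDerivatives
import Literature.NumberTheory.LFunctions.RiemannXiHadamardProduct
import HarnessLib

/-!
# Crux `SigmaL` (stmt-RiemannHypothesis-24253) — energy identity, part 1: the pair terms
# `Zₙ(1, ½+it) = (s−ρₙ)⁻² + (s−(1−ρₙ))⁻²` of `ξ` on the critical line and the sign of their real parts

Skeleton `SigmaL_birth`, registered stub `stub_laguerreAtCritical : ∀ t > 3·10¹², Z'(t) = 0 → Z(t) ≠ 0 →
Z(t)·Z''(t) < 0` (RH-strength, OPEN). Companion module `HardyZLehmerSplitSigmaLLaguerreEnergy` proves the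
ENERGY IDENTITY `(Z''Z − Z'²)/Z²(t) = Σₙ Re Zₙ(1, ½+it) + c'(t)` (`c'(t) ≤ 4/t`), RH-free, from the tree's
termwise-differentiated Hadamard expansion `Stark1974.SymmHadamardData.iteratedDeriv_logDeriv_eq` (k = 1).
This module is the termwise bookkeeping it needs, for a Hadamard datum `D : SymmHadamardData riemannXi`
(nodes `ζₙ`, zeros `ρₙ = ½ + ζₙ`, `1 − ρₙ = ½ − ζₙ`):

* §1 `Re (w²)⁻¹ = (Re w² − Im w²)/((Re w² + Im w²)²)` and its sign: `≤ 0` when `Re w² ≤ Im w²` (off the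
  exact cone), `≤ 1/‖w‖²` always, `≤ −(Im w² − ¼)/((Im w² + ¼)²)` when `Re w² ≤ ¼ ≤ Im w²`; `D.m = 0` for `ξ`;
* §2 `Re Zₙ(1, ½+it)` written out (`re_zeroTerm_one_eq`, `re_zeroTerm_one_eq_of_root`):
  `((β−½)² − (t−γ)²)/(((β−½)²+(t−γ)²)²) + ((β−½)² − (t+γ)²)/(((β−½)²+(t+γ)²)²)` for the pair through
  `ρ = β + iγ` — MINUS the ENERGY of the pair at `t`; nonpositive off the exact cones
  (`re_zeroTerm_one_nonpos_of_offCone`), at most `−((t−γ)²−¼)/(((t−γ)²+¼)²) − …` once both ordinates are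
  at distance `≥ ½` from `t` whatever the real part (`re_zeroTerm_one_le_of_quarter_le`, using `|β−½| ≤ ½`),
  and never more than `1/((β−½)²+(t−γ)²) + 1/((β−½)²+(t+γ)²)` (`re_zeroTerm_one_le`, the in-cone penalty).

Pure algebra about the zeros of `ξ`; NOTHING HERE PROVES OR ASSUMES RH; the stub stays OPEN.
References: Ivić 2003 §2 [Ivic2003]; Lagarias–Montgomery–Odlyzko 1979 §3 [LagariasMontgomeryOdlyzko1979].
-/

noncomputable section

set_option linter.dupNamespace false
set_option autoImplicit false

open Complex Filter Set
open scoped Real Topology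
open Literature.NumberTheory.LFunctions
open Literature.NumberTheory.LFunctions.Stark1974

namespace Summit.RiemannHypothesis.RiemannHypothesis.Theorems.SigmaLBirth

variable (D : SymmHadamardData riemannXi)

/-! ## §1. The Hadamard datum of `ξ` has no zero at `½`; the real part of one pair term -/

/-- For `ξ` the order of vanishing at `½` is `0` (`ξ(½) ≠ 0`). [folklore] -/
theorem symmHadamardData_m_eq_zero : D.m = 0 := by
  rcases D.m_eq_zero_or_ne_half riemannXi_one_half_ne_zero with h | h
  · exact h
  · exact absurd rfl h

/-- `Re (w²)⁻¹ = (Re w² − Im w²)/((Re w² + Im w²)²)` (both sides `0` at `w = 0`). [folklore] -/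
theorem re_inv_sq (w : ℂ) : ((w ^ 2)⁻¹).re = (w.re ^ 2 - w.im ^ 2) / (w.re ^ 2 + w.im ^ 2) ^ 2 := by
  rw [Complex.inv_re, map_pow, Complex.normSq_apply]
  simp [pow_two, Complex.mul_re]

/-- `Re [(w₁²)⁻¹ + (w₂²)⁻¹]` written out. [folklore] -/
theorem re_inv_sq_add_inv_sq (w₁ w₂ : ℂ) :
    ((w₁ ^ 2)⁻¹ + (w₂ ^ 2)⁻¹).re =
      (w₁.re ^ 2 - w₁.im ^ 2) / (w₁.re ^ 2 + w₁.im ^ 2) ^ 2 +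
        (w₂.re ^ 2 - w₂.im ^ 2) / (w₂.re ^ 2 + w₂.im ^ 2) ^ 2 := by
  rw [Complex.add_re, re_inv_sq, re_inv_sq]

/-- `Re (w²)⁻¹ ≤ 0` as soon as `Re w² ≤ Im w²` (outside the exact cone). [folklore] -/
theorem re_inv_sq_nonpos {w : ℂ} (h : w.re ^ 2 ≤ w.im ^ 2) : ((w ^ 2)⁻¹).re ≤ 0 := by
  rw [re_inv_sq]
  exact div_nonpos_of_nonpos_of_nonneg (by linarith) (by positivity)

/-- `Re (w²)⁻¹ ≤ 1/(Re w² + Im w²)` always (the in-cone penalty is at most `1/‖w‖²`). [folklore] -/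
theorem re_inv_sq_le (w : ℂ) : ((w ^ 2)⁻¹).re ≤ 1 / (w.re ^ 2 + w.im ^ 2) := by
  rw [re_inv_sq]
  rcases eq_or_lt_of_le (add_nonneg (sq_nonneg w.re) (sq_nonneg w.im)) with h0 | hpos
  · rw [← h0]; simp
  · rw [div_le_div_iff₀ (by positivity) hpos]
    nlinarith [sq_nonneg w.im, sq_nonneg w.re]

/-- Off the cone with margin: if `Re w² ≤ ¼ ≤ Im w²` then `Re (w²)⁻¹ ≤ −(Im w² − ¼)/((Im w² + ¼)²)`
(the map `d ↦ (u² − d)/(u² + d)²` decreases on `0 ≤ d ≤ u²`). [folklore] -/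
theorem re_inv_sq_le_of_quarter_le {w : ℂ} (hre : w.re ^ 2 ≤ 1 / 4) (him : 1 / 4 ≤ w.im ^ 2) :
    ((w ^ 2)⁻¹).re ≤ -((w.im ^ 2 - 1 / 4) / (w.im ^ 2 + 1 / 4) ^ 2) := by
  rw [re_inv_sq]
  have hpos : 0 < (w.re ^ 2 + w.im ^ 2) ^ 2 := by positivity
  have hpos' : 0 < (w.im ^ 2 + 1 / 4) ^ 2 := by positivity
  rw [le_neg_iff_add_nonpos_left, div_add_div _ _ hpos'.ne' hpos.ne']
  refine div_nonpos_of_nonpos_of_nonneg ?_ (by positivity)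
  have e : (w.im ^ 2 - 1 / 4) * (w.re ^ 2 + w.im ^ 2) ^ 2 +
      (w.im ^ 2 + 1 / 4) ^ 2 * (w.re ^ 2 - w.im ^ 2) =
      (w.re ^ 2 - 1 / 4) * ((w.im ^ 2 - 1 / 4) * w.re ^ 2 + 3 * (w.im ^ 2) ^ 2 + w.im ^ 2 / 4) := by
    ring
  rw [e]
  refine mul_nonpos_iff.2 (Or.inr ⟨by linarith, ?_⟩)
  have h1 : 0 ≤ (w.im ^ 2 - 1 / 4) * w.re ^ 2 := mul_nonneg (by linarith) (sq_nonneg _)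
  positivity


/-! ## §2. The pair terms `Zₙ(1, s) = (s−ρₙ)⁻² + (s−(1−ρₙ))⁻²` of `ξ` on the critical line -/

/-- The point `s(u) = ½ + iu` of the critical line moves with velocity `i`. [folklore] -/
theorem hasDerivAt_critLinePt (t : ℝ) :
    HasDerivAt (fun u : ℝ ↦ (1 / 2 : ℂ) + (u : ℂ) * I) I t := by
  have h : HasDerivAt (fun u : ℝ ↦ (u : ℂ) * I) ((1 : ℝ) * I) t :=
    ((hasDerivAt_id t).ofReal_comp).mul_const I
  simpa using h.const_add (1 / 2 : ℂ)

/-- **`Re Zₙ(1, ½+it)` written out.** With `ζₙ = βₙ' + iγₙ` the `n`-th Hadamard node of `ξ` (so the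
pair of zeros is `ρₙ = ½ + ζₙ`, `1 − ρₙ = ½ − ζₙ`, `βₙ' = Re ρₙ − ½`):
`Re Zₙ(1, ½+it) = (βₙ'² − (t−γₙ)²)/((βₙ'² + (t−γₙ)²)²) + (βₙ'² − (t+γₙ)²)/((βₙ'² + (t+γₙ)²)²)` — minus
the ENERGY of the pair at `t`: negative exactly when `t` is outside the exact cones `|t ∓ γₙ| < |βₙ'|`.
[folklore] -/
theorem re_zeroTerm_one_eq {n : ℕ} (hn : D.c n ≠ 0) (t : ℝ) :
    (D.zeroTerm 1 (1 / 2 + (t : ℂ) * I) n).re =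
      ((D.node n).re ^ 2 - (t - (D.node n).im) ^ 2) /
          ((D.node n).re ^ 2 + (t - (D.node n).im) ^ 2) ^ 2 +
        ((D.node n).re ^ 2 - (t + (D.node n).im) ^ 2) /
          ((D.node n).re ^ 2 + (t + (D.node n).im) ^ 2) ^ 2 := by
  simp only [SymmHadamardData.zeroTerm, if_neg hn, Nat.reduceAdd, re_inv_sq_add_inv_sq]
  have h1 : ((1 / 2 : ℂ) + (t : ℂ) * I - 1 / 2 - D.node n).re = -(D.node n).re := by simp
  have h2 : ((1 / 2 : ℂ) + (t : ℂ) * I - 1 / 2 - D.node n).im = t - (D.node n).im := by simp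
  have h3 : ((1 / 2 : ℂ) + (t : ℂ) * I - 1 / 2 + D.node n).re = (D.node n).re := by simp
  have h4 : ((1 / 2 : ℂ) + (t : ℂ) * I - 1 / 2 + D.node n).im = t + (D.node n).im := by simp
  rw [h1, h2, h3, h4, neg_sq]

/-- **In root form.** If the `n`-th factor carries the zero `ρ = β + iγ` of `ξ` (`cₙ(ρ − ½)² = −1`), then
`Re Zₙ(1, ½+it) = ((β−½)² − (t−γ)²)/(((β−½)² + (t−γ)²)²) + ((β−½)² − (t+γ)²)/(((β−½)² + (t+γ)²)²)`
(the pair `{ρ, 1−ρ}`; the partner `1 − ρ` has ordinate `−γ`). [folklore] -/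
theorem re_zeroTerm_one_eq_of_root {ρ : ℂ} {n : ℕ} (h : D.c n * (ρ - 1 / 2) ^ 2 = -1) (t : ℝ) :
    (D.zeroTerm 1 (1 / 2 + (t : ℂ) * I) n).re =
      ((ρ.re - 1 / 2) ^ 2 - (t - ρ.im) ^ 2) / ((ρ.re - 1 / 2) ^ 2 + (t - ρ.im) ^ 2) ^ 2 +
        ((ρ.re - 1 / 2) ^ 2 - (t + ρ.im) ^ 2) / ((ρ.re - 1 / 2) ^ 2 + (t + ρ.im) ^ 2) ^ 2 := by
  rw [D.zeroTerm_eq_of_root h 1 _]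
  simp only [Nat.reduceAdd, re_inv_sq_add_inv_sq]
  have h1 : ((1 / 2 : ℂ) + (t : ℂ) * I - ρ).re = -(ρ.re - 1 / 2) := by simp
  have h2 : ((1 / 2 : ℂ) + (t : ℂ) * I - ρ).im = t - ρ.im := by simp
  have h3 : ((1 / 2 : ℂ) + (t : ℂ) * I - (1 - ρ)).re = ρ.re - 1 / 2 := by simp; ring
  have h4 : ((1 / 2 : ℂ) + (t : ℂ) * I - (1 - ρ)).im = t + ρ.im := by simp
  rw [h1, h2, h3, h4, neg_sq]

/-- **Off the exact cones the pair term is `≤ 0`** (nonnegative energy): if `βₙ'² ≤ (t − γₙ)²` and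
`βₙ'² ≤ (t + γₙ)²` then `Re Zₙ(1, ½+it) ≤ 0`. [folklore] -/
theorem re_zeroTerm_one_nonpos_of_offCone {n : ℕ} {t : ℝ}
    (h₁ : (D.node n).re ^ 2 ≤ (t - (D.node n).im) ^ 2)
    (h₂ : (D.node n).re ^ 2 ≤ (t + (D.node n).im) ^ 2) :
    (D.zeroTerm 1 (1 / 2 + (t : ℂ) * I) n).re ≤ 0 := by
  by_cases hn : D.c n = 0
  · simp [SymmHadamardData.zeroTerm, hn]
  simp only [SymmHadamardData.zeroTerm, if_neg hn, Nat.reduceAdd, Complex.add_re]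
  have h1 : ((1 / 2 : ℂ) + (t : ℂ) * I - 1 / 2 - D.node n).re = -(D.node n).re := by simp
  have h2 : ((1 / 2 : ℂ) + (t : ℂ) * I - 1 / 2 - D.node n).im = t - (D.node n).im := by simp
  have h3 : ((1 / 2 : ℂ) + (t : ℂ) * I - 1 / 2 + D.node n).re = (D.node n).re := by simp
  have h4 : ((1 / 2 : ℂ) + (t : ℂ) * I - 1 / 2 + D.node n).im = t + (D.node n).im := by simp
  have e1 := re_inv_sq_nonpos (w := (1 / 2 : ℂ) + (t : ℂ) * I - 1 / 2 - D.node n)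
    (by rw [h1, h2, neg_sq]; exact h₁)
  have e2 := re_inv_sq_nonpos (w := (1 / 2 : ℂ) + (t : ℂ) * I - 1 / 2 + D.node n)
    (by rw [h3, h4]; exact h₂)
  linarith

/-- **The in-cone penalty is bounded**: always
`Re Zₙ(1, ½+it) ≤ 1/(βₙ'² + (t−γₙ)²) + 1/(βₙ'² + (t+γₙ)²)` (`Re w⁻² ≤ ‖w‖⁻²`). [folklore] -/
theorem re_zeroTerm_one_le {n : ℕ} (hn : D.c n ≠ 0) (t : ℝ) :
    (D.zeroTerm 1 (1 / 2 + (t : ℂ) * I) n).re ≤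
      1 / ((D.node n).re ^ 2 + (t - (D.node n).im) ^ 2) +
        1 / ((D.node n).re ^ 2 + (t + (D.node n).im) ^ 2) := by
  simp only [SymmHadamardData.zeroTerm, if_neg hn, Nat.reduceAdd, Complex.add_re]
  have h1 : ((1 / 2 : ℂ) + (t : ℂ) * I - 1 / 2 - D.node n).re = -(D.node n).re := by simp
  have h2 : ((1 / 2 : ℂ) + (t : ℂ) * I - 1 / 2 - D.node n).im = t - (D.node n).im := by simp
  have h3 : ((1 / 2 : ℂ) + (t : ℂ) * I - 1 / 2 + D.node n).re = (D.node n).re := by simp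
  have h4 : ((1 / 2 : ℂ) + (t : ℂ) * I - 1 / 2 + D.node n).im = t + (D.node n).im := by simp
  have e1 := re_inv_sq_le ((1 / 2 : ℂ) + (t : ℂ) * I - 1 / 2 - D.node n)
  have e2 := re_inv_sq_le ((1 / 2 : ℂ) + (t : ℂ) * I - 1 / 2 + D.node n)
  rw [h1, h2, neg_sq] at e1
  rw [h3, h4] at e2
  linarith

/-- **Off-cone with margin ½**: a pair of zeros of `ξ` (so `|βₙ'| ≤ ½`, `SymmHadamardData.abs_re_node_le`)
both of whose ordinates `±γₙ` are at distance `≥ ½` from `t` has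
`Re Zₙ(1, ½+it) ≤ −((t−γₙ)² − ¼)/(((t−γₙ)² + ¼)²) − ((t+γₙ)² − ¼)/(((t+γₙ)² + ¼)²)` — a DEFINITE
negative amount, whatever the real part of the zero. [folklore] -/
theorem re_zeroTerm_one_le_of_quarter_le {n : ℕ} (hn : D.c n ≠ 0) {t : ℝ}
    (h₁ : 1 / 4 ≤ (t - (D.node n).im) ^ 2) (h₂ : 1 / 4 ≤ (t + (D.node n).im) ^ 2) :
    (D.zeroTerm 1 (1 / 2 + (t : ℂ) * I) n).re ≤
      -(((t - (D.node n).im) ^ 2 - 1 / 4) / ((t - (D.node n).im) ^ 2 + 1 / 4) ^ 2) -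
        ((t + (D.node n).im) ^ 2 - 1 / 4) / ((t + (D.node n).im) ^ 2 + 1 / 4) ^ 2 := by
  have hβ : (D.node n).re ^ 2 ≤ 1 / 4 := by
    have h := abs_le.1 (D.abs_re_node_le hn)
    nlinarith [h.1, h.2]
  simp only [SymmHadamardData.zeroTerm, if_neg hn, Nat.reduceAdd, Complex.add_re]
  have h1 : ((1 / 2 : ℂ) + (t : ℂ) * I - 1 / 2 - D.node n).re = -(D.node n).re := by simp
  have h2 : ((1 / 2 : ℂ) + (t : ℂ) * I - 1 / 2 - D.node n).im = t - (D.node n).im := by simp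
  have h3 : ((1 / 2 : ℂ) + (t : ℂ) * I - 1 / 2 + D.node n).re = (D.node n).re := by simp
  have h4 : ((1 / 2 : ℂ) + (t : ℂ) * I - 1 / 2 + D.node n).im = t + (D.node n).im := by simp
  have e1 := re_inv_sq_le_of_quarter_le (w := (1 / 2 : ℂ) + (t : ℂ) * I - 1 / 2 - D.node n)
    (by rw [h1, neg_sq]; exact hβ) (by rw [h2]; exact h₁)
  have e2 := re_inv_sq_le_of_quarter_le (w := (1 / 2 : ℂ) + (t : ℂ) * I - 1 / 2 + D.node n)
    (by rw [h3]; exact hβ) (by rw [h4]; exact h₂)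
  rw [h2] at e1
  rw [h4] at e2
  linarith

end Summit.RiemannHypothesis.RiemannHypothesis.Theorems.SigmaLBirth

end
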